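import Literature.MathematicalPhysics.QuantumLattice.LatticeGaugeDLRFarFactorProofs
import Literature.MathematicalPhysics.QuantumLattice.LatticeGaugeDLRCovarianceSplit
import Literature.MathematicalPhysics.QuantumFieldTheory.LatticeGaugeShenZhuZhuProofs
import Literature.Probability.LatticeModels.CoarseCellMixingDLR
import HarnessLib

/-!
# Torus Wilson states: covariances are controlled by the boundary influence of a box kernel

Helper file for item `stmt-QuantumFields-8895` (`FiniteSizeCriterion` of route `OneCertifiedCube`,
sub-problem `YangMills`).

* `integral_torusLift_mul_eq_integral_ymSpecification_mul_of_measurable` — the local DLR equation of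
  the torus Wilson state with a far factor
  (`Literature.MathematicalPhysics.QuantumLattice.integral_torusLift_mul_eq_integral_ymSpecification_mul`)
  for a bounded MEASURABLE (rather than continuous) cylinder observable `F`; the tree's proof is
  copied verbatim, continuity being used there only to supply measurability.
* `abs_latticeConnectedCorr_le_of_influence` — for bounded measurable cylinder observables `A`, `B`
  of `ℤ⁴`, a finite link set `Λ` which together with the support of `A` and its collar injects into
  the torus of side `M`, and whose torus image misses the support of the time-`t` translate of `B`:
  if the kernel means `γ_Λ A (η)` of the lattice Yang–Mills specification vary by at most `Δ` over
  ALL exterior data `η`, then `|⟨A · τ_t B⟩ − ⟨A⟩⟨B⟩| ≤ ‖B‖_∞ Δ` on the torus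
  (`QuantumFieldTheory.latticeConnectedCorr`): DLR with far factor `τ_t B`, translation invariance
  `⟨τ_t B⟩ = ⟨B⟩`, and `|γ_Λ A(η) − ⟨γ_Λ A⟩| ≤ Δ` (Georgii 2011, §8.2, (8.29)–(8.31)).

## References

* H.-O. Georgii, *Gibbs Measures and Phase Transitions*, 2nd ed. (de Gruyter 2011), Prop. 2.5,
  Thm. 4.17, §8.2.
* E. Seiler, LNP 159 (Springer 1982), Ch. 2.
-/

set_option autoImplicit false

noncomputable section

open MeasureTheory Filter Finset
open Literature.Probability.LatticeModels
open Literature.MathematicalPhysics.QuantumLattice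
open Literature.MathematicalPhysics.QuantumFieldTheory (GaugeConfig Edge Plaquette plaquetteHolonomy
  wilsonAction wilsonMeasure haarProbability wilsonExpectation isProbabilityMeasure_wilsonMeasure
  latticeConnectedCorr measurable_torusLift isSpecification_ymSpecification_of_t2Space)

namespace Summit.QuantumFields.YangMills.Theorems.FiniteSizeCriterion

/-! ## The torus DLR identity with a far factor, measurable observable -/

section FarFactorDLR

variable {d N : ℕ} {G : Type*} [Group G] [TopologicalSpace G] [IsTopologicalGroup G]
  [CompactSpace G] [MeasurableSpace G] [BorelSpace G] [SecondCountableTopology G]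
  (ρ : G →* Matrix (Fin N) (Fin N) ℂ)

/-- **Torus Wilson states satisfy the local DLR equations of `ymSpecification`, with a far factor;
bounded measurable observable.** Verbatim the tree's
`integral_torusLift_mul_eq_integral_ymSpecification_mul` (Georgii 2011, proof of Thm. 4.17, (4.18);
Friedli–Velenik 2017, Lemma 6.7 and (6.34)), with `F` only assumed measurable: for a bounded
measurable cylinder observable `F` on `ℤ^d` with support `S₀`, a torus size `L` such that reduction
mod `L` is injective on the base points of `Λ ∪ S₀ ∪ ∂Λ`, and a bounded measurable torus observable
`H` unchanged by resampling the links over the image of `Λ`,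
`∫ F(lift V) · H(V) dμ = ∫ (γ_Λ F)(lift V) · H(V) dμ`. -/
theorem integral_torusLift_mul_eq_integral_ymSpecification_mul_of_measurable (hρ : Continuous ρ)
    (β : ℝ) (Λ : Finset (ZdEdge d)) {F : LGConfig d G → ℝ} (hF : Measurable F) {C : ℝ}
    (hC : ∀ U, |F U| ≤ C) {S₀ : Finset (ZdEdge d)} (hFS : IsCylinder F S₀) {L : ℕ} [NeZero L]
    (hL : Set.InjOn (Torus.proj L)
      ((Λ ∪ S₀ ∪ (plaquettesTouching Λ).biUnion plaquetteEdges).image Prod.fst :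
        Set (Site d)))
    {H : GaugeConfig d L G → ℝ} (hHm : Measurable H) {D : ℝ} (hHD : ∀ V, |H V| ≤ D)
    (hH : ∀ W V, H ((Λ.image (torusEdge L)).piecewise W V) = H V) :
    ∫ V, F (torusLift L V) * H V ∂(wilsonMeasure ρ β) =
      ∫ V, (∫ U, F U ∂(ymSpecification ρ β Λ (torusLift L V))) * H V ∂(wilsonMeasure ρ β) := by
  classical
  -- the relevant finite edge set `T` and the injectivity consequences of `hL`
  have hΛT : Λ ⊆ Λ ∪ S₀ ∪ (plaquettesTouching Λ).biUnion plaquetteEdges :=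
    (subset_union_left).trans subset_union_left
  have hS₀T : S₀ ⊆ Λ ∪ S₀ ∪ (plaquettesTouching Λ).biUnion plaquetteEdges :=
    (subset_union_right).trans subset_union_left
  have hPT : (plaquettesTouching Λ).biUnion plaquetteEdges ⊆
      Λ ∪ S₀ ∪ (plaquettesTouching Λ).biUnion plaquetteEdges := subset_union_right
  have hTinj := injOn_torusEdge hL
  have hPinj := injOn_projPlaquette (image_subset_image hPT) hL
  -- near and far parts of the torus action
  set a : GaugeConfig d L G → ℝ := fun V =>
    -β * ∑ q ∈ (plaquettesTouching Λ).image
        (fun p : ZdPlaquette d => ((Torus.proj L p.1, p.2) : Plaquette d L)),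
      ((N : ℝ) - (ρ (plaquetteHolonomy V q.1 q.2.1.1 q.2.1.2)).trace.re)
    with ha_def
  set b : GaugeConfig d L G → ℝ := fun V =>
    -β * ∑ q ∈ ((plaquettesTouching Λ).image
        (fun p : ZdPlaquette d => ((Torus.proj L p.1, p.2) : Plaquette d L)))ᶜ,
      ((N : ℝ) - (ρ (plaquetteHolonomy V q.1 q.2.1.1 q.2.1.2)).trace.re)
    with hb_def
  have hab : ∀ V, -β * wilsonAction ρ V = a V + b V := fun V => by
    simp only [ha_def, hb_def, wilsonAction, ← mul_add, Finset.sum_add_sum_compl]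
  have ha : ∀ V, a V = -β * wilsonBoundaryAction ρ Λ (torusLift L V) := fun V => by
    simp only [ha_def, sum_image_proj_plaquetteTerm ρ hPinj]
  have hb : ∀ W V, b ((Λ.image (torusEdge L)).piecewise W V) = b V := fun W V => by
    simp only [hb_def]
    congr 1
    refine Finset.sum_congr rfl fun q hq => ?_
    rw [plaquetteHolonomy_piecewise_of_ne (fun p hp h => (Finset.mem_compl.1 hq)
      (Finset.mem_image.2 ⟨p, hp, h⟩)) W V]
  have hac : Continuous a :=
    continuous_const.mul (continuous_finsetSum _ fun q _ => continuous_plaquetteTerm ρ hρ q)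
  have hbc : Continuous b :=
    continuous_const.mul (continuous_finsetSum _ fun q _ => continuous_plaquetteTerm ρ hρ q)
  obtain ⟨A, hA⟩ := exists_bound_of_continuous hac
  obtain ⟨B, hB⟩ := exists_bound_of_continuous hbc
  have hFt : Measurable fun V : GaugeConfig d L G => F (torusLift L V) :=
    hF.comp (measurable_torusLift L)
  -- transfer of the fibre integrals from `G^Λ` to the torus
  have hτ : Function.Injective fun e : ↥Λ => torusEdge L (e : ZdEdge d) := fun e₁ e₂ h =>
    Subtype.ext (hTinj (hΛT e₁.2) (hΛT e₂.2) h)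
  have transfer : ∀ Φ : LGConfig d G → ℝ, Measurable Φ →
      DependsOn Φ ↑(Λ ∪ S₀ ∪ (plaquettesTouching Λ).biUnion plaquetteEdges) →
      ∀ V : GaugeConfig d L G,
        ∫ ζ, Φ (glueWith Λ ζ (torusLift L V)) ∂(Measure.pi fun _ : ↥Λ => haarProbability G) =
          ∫ W, Φ (torusLift L ((Λ.image (torusEdge L)).piecewise W V))
            ∂(Measure.pi fun _ : Edge d L => haarProbability G) := by
    intro Φ hΦm hΦT V
    have hm : Measurable fun (W : GaugeConfig d L G) (e : ↥Λ) => W (torusEdge L (e : ZdEdge d)) :=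
      measurable_pi_iff.2 fun e => measurable_pi_apply _
    have hc : Measurable fun ζ : ↥Λ → G => Φ (glueWith Λ ζ (torusLift L V)) :=
      hΦm.comp (measurable_glueWith Λ (torusLift L V))
    rw [← pi_map_comp_injective (haarProbability G) hτ,
      integral_map hm.aemeasurable hc.aestronglyMeasurable]
    refine congrArg _ (funext fun W => hΦT fun e he => ?_)
    exact (torusLift_piecewise_apply hΛT hTinj W V he).symm
  -- locality of the two fibre integrands
  have hST : DependsOn (wilsonBoundaryAction (G := G) ρ Λ)
      ↑(Λ ∪ S₀ ∪ (plaquettesTouching Λ).biUnion plaquetteEdges) :=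
    (isCylinder_wilsonBoundaryAction_holds (G := G) ρ Λ).mono (Finset.coe_subset.2 hPT)
  have hFT : DependsOn F ↑(Λ ∪ S₀ ∪ (plaquettesTouching Λ).biUnion plaquetteEdges) :=
    hFS.mono (Finset.coe_subset.2 hS₀T)
  have hw : Continuous fun U : LGConfig d G => Real.exp (-β * wilsonBoundaryAction ρ Λ U) :=
    Real.continuous_exp.comp (continuous_const.mul (continuous_wilsonBoundaryAction ρ hρ Λ))
  -- the kernel average of `F` at a periodic boundary condition, computed on the torus
  have key : ∀ V : GaugeConfig d L G,
      ∫ U, F U ∂(ymSpecification ρ β Λ (torusLift L V)) =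
        (∫ W, F (torusLift L ((Λ.image (torusEdge L)).piecewise W V)) *
            Real.exp (a ((Λ.image (torusEdge L)).piecewise W V))
            ∂(Measure.pi fun _ : Edge d L => haarProbability G)) /
          ∫ W, Real.exp (a ((Λ.image (torusEdge L)).piecewise W V))
            ∂(Measure.pi fun _ : Edge d L => haarProbability G) := by
    intro V
    rw [integral_ymSpecification ρ hρ β Λ hF,
      transfer (fun U => F U * Real.exp (-β * wilsonBoundaryAction ρ Λ U)) (hF.mul hw.measurable)
        (fun x y h => by simp only [hFT h, hST h]),
      transfer (fun U => Real.exp (-β * wilsonBoundaryAction ρ Λ U)) hw.measurable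
        (fun x y h => by simp only [hST h])]
    simp only [ha]
  -- conclude with the finite-volume DLR identity on the torus, for the observable `(F ∘ lift) · H`
  change wilsonExpectation ρ β (fun V => F (torusLift L V) * H V) =
    wilsonExpectation ρ β (fun V => (∫ U, F U ∂(ymSpecification ρ β Λ (torusLift L V))) * H V)
  rw [wilsonExpectation_eq_toReal_mul_integral ρ hρ β,
    wilsonExpectation_eq_toReal_mul_integral ρ hρ β]
  congr 1
  simp only [key, hab, div_mul_eq_mul_div]
  exact integral_exp_mul_eq_integral_exp_mul_condAvg (haarProbability G)
    (Λ.image (torusEdge L)) (F := fun V => F (torusLift L V) * H V)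
    (NF := fun V => (∫ W, F (torusLift L ((Λ.image (torusEdge L)).piecewise W V)) *
      Real.exp (a ((Λ.image (torusEdge L)).piecewise W V))
        ∂(Measure.pi fun _ : Edge d L => haarProbability G)) * H V)
    (N1 := fun V => ∫ W, Real.exp (a ((Λ.image (torusEdge L)).piecewise W V))
        ∂(Measure.pi fun _ : Edge d L => haarProbability G))
    (hFt.mul hHm) hac.measurable hbc.measurable (C := C * D)
    (fun V => by
      rw [abs_mul]
      exact mul_le_mul (hC _) (hHD V) (abs_nonneg _) ((abs_nonneg _).trans (hC (torusLift L V))))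
    hA hB hb
    (fun V => by
      simp only [hH]
      rw [← integral_mul_const]
      exact congrArg _ (funext fun W => by ring))
    (fun V => rfl)

end FarFactorDLR

/-! ## Covariances on the torus through the boundary influence of one kernel -/

section Covariance

variable {N : ℕ} {G : Type} [Group G] [TopologicalSpace G] [IsTopologicalGroup G]
  [CompactSpace G] [MeasurableSpace G] [BorelSpace G] [SecondCountableTopology G] [T2Space G]
  (ρ : G →* Matrix (Fin N) (Fin N) ℂ)

/-- The mean of a bounded function against a probability measure is within `Δ` of any of its
values, if all its values are within `Δ` of each other. -/
theorem abs_sub_integral_le_of_forall {X : Type*} [MeasurableSpace X] (μ : Measure X)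
    [IsProbabilityMeasure μ] {g : X → ℝ} (hgm : Measurable g) {C : ℝ} (hgb : ∀ x, |g x| ≤ C)
    {Δ : ℝ} (hΔ : ∀ x y, |g x - g y| ≤ Δ) (x : X) : |g x - ∫ y, g y ∂μ| ≤ Δ := by
  have hgi : Integrable g μ := integrable_of_abs_le hgm hgb
  have e : g x - ∫ y, g y ∂μ = ∫ y, (g x - g y) ∂μ := by
    rw [integral_sub (integrable_const _) hgi, integral_const]
    simp
  rw [e]
  exact abs_integral_le_of_abs_le fun y => hΔ x y

/-- **Covariances on the torus are controlled by the boundary influence of a box kernel.** Torus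
of side `M`, Wilson state `μ = wilsonMeasure ρ β`; bounded measurable cylinder observables `A`
(support `SA`) and `B` (support `SB`) of `ℤ⁴`; a finite link set `Λ` such that `Λ ∪ SA ∪ ∂Λ`
injects into the torus and the torus image of `Λ` misses that of the support `SB + t e₀` of the
time-`t` translate of `B`. If the kernel means `γ_Λ A (η)` vary by at most `Δ` over all exterior
data, then `|⟨A · τ_t B⟩_M − ⟨A⟩_M ⟨B⟩_M| ≤ ‖B‖_∞ Δ`. Proof: the far-factor DLR identity
(`integral_torusLift_mul_eq_integral_ymSpecification_mul_of_measurable`) for `A` with far factor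
`τ_t B ∘ lift` and with far factor `1`, translation invariance `⟨τ_t B⟩ = ⟨B⟩`
(`integral_comp_configShift_torusLift`), so that the covariance is `∫ (γ_Λ A(Ũ) − ⟨γ_Λ A⟩) τ_tB(Ũ) dμ`,
and `|γ_Λ A (η) − ⟨γ_Λ A⟩| ≤ Δ` (Georgii 2011, §8.2). -/
theorem abs_latticeConnectedCorr_le_of_influence (hρ : Continuous ρ) (β : ℝ) {M : ℕ} [NeZero M]
    (Λ : Finset (ZdEdge 4)) {A B : LGConfig 4 G → ℝ} (hAm : Measurable A) (hBm : Measurable B)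
    {CA CB : ℝ} (hAb : ∀ U, |A U| ≤ CA) (hBb : ∀ U, |B U| ≤ CB)
    {SA SB : Finset (ZdEdge 4)} (hAS : IsCylinder A SA) (hBS : IsCylinder B SB) (t : ℕ)
    (hinj : Set.InjOn (Torus.proj M)
      ((Λ ∪ SA ∪ (plaquettesTouching Λ).biUnion plaquetteEdges).image Prod.fst : Set (Site 4)))
    (hfar : ∀ e ∈ SB.image (fun e : ZdEdge 4 => (e.1 - -Pi.single 0 (t : ℤ), e.2)), ∀ e' ∈ Λ,
      torusEdge M e ≠ torusEdge M e')
    {Δ : ℝ} (hΔ : ∀ η η' : LGConfig 4 G,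
      |(∫ U, A U ∂(ymSpecification ρ β Λ η)) - ∫ U, A U ∂(ymSpecification ρ β Λ η')| ≤ Δ) :
    |latticeConnectedCorr ρ β M A B t| ≤ CB * Δ := by
  classical
  haveI := isProbabilityMeasure_wilsonMeasure (d := 4) (L := M) ρ hρ β
  have hγ := isSpecification_ymSpecification_of_t2Space (d := 4) ρ hρ β
  -- the kernel mean of `A` and the far factor
  set g : LGConfig 4 G → ℝ := fun η => ∫ U, A U ∂(ymSpecification ρ β Λ η) with hgdef
  have hgm : Measurable g := DobrushinShlosman.measurable_windowAvg' hγ Λ hAm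
  have hgb : ∀ η, |g η| ≤ CA := fun η => abs_integral_ymSpecification_le ρ hρ β Λ hAb η
  set v : Fin 4 → ℤ := -Pi.single 0 (t : ℤ) with hv
  set H : GaugeConfig 4 M G → ℝ := fun V =>
    B (Literature.MathematicalPhysics.QuantumLattice.configShift v (torusLift M V)) with hHdef
  have hHm : Measurable H :=
    hBm.comp ((Literature.MathematicalPhysics.QuantumLattice.configShift v).measurable.comp
      (measurable_torusLift M))
  have hHb : ∀ V, |H V| ≤ CB := fun V => hBb _
  have hHS : IsCylinder (B ∘ Literature.MathematicalPhysics.QuantumLattice.configShift v)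
      (SB.image fun e : ZdEdge 4 => (e.1 - v, e.2)) :=
    Literature.MathematicalPhysics.QuantumFieldTheory.IsCylinder.comp_configShift hBS v
  have hHpw : ∀ W V, H (((Λ.image (torusEdge M)).piecewise W V)) = H V := fun W V =>
    apply_torusLift_piecewise_eq hHS hfar W V
  -- the two DLR identities and translation invariance
  have h1 := integral_torusLift_mul_eq_integral_ymSpecification_mul_of_measurable ρ hρ β Λ hAm hAb
    hAS hinj hHm hHb hHpw
  have h2 := integral_torusLift_mul_eq_integral_ymSpecification_mul_of_measurable ρ hρ β Λ hAm hAb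
    hAS hinj (H := fun _ => (1 : ℝ)) measurable_const (D := 1) (fun _ => by simp) (fun _ _ => rfl)
  simp only [mul_one] at h2
  have h3 := integral_comp_configShift_torusLift (S := M) ρ β B v
  -- the covariance through the kernel mean
  set m : ℝ := ∫ V, g (torusLift M V) ∂(wilsonMeasure (d := 4) (L := M) ρ β) with hm
  have hgl : Measurable fun V : GaugeConfig 4 M G => g (torusLift M V) :=
    hgm.comp (measurable_torusLift M)
  have hgHi : Integrable (fun V => g (torusLift M V) * H V) (wilsonMeasure (d := 4) (L := M) ρ β) :=
    integrable_of_abs_le (hgl.mul hHm) (C := CA * CB) fun V => by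
      rw [abs_mul]
      have e1 := hgb (torusLift M V)
      have e2 := hHb V
      have e3 : 0 ≤ CA := (abs_nonneg _).trans e1
      exact mul_le_mul e1 e2 (abs_nonneg _) e3
  have hHi : Integrable H (wilsonMeasure (d := 4) (L := M) ρ β) := integrable_of_abs_le hHm hHb
  have hcov : latticeConnectedCorr ρ β M A B t =
      ∫ V, (g (torusLift M V) - m) * H V ∂(wilsonMeasure (d := 4) (L := M) ρ β) := by
    unfold Literature.MathematicalPhysics.QuantumFieldTheory.latticeConnectedCorr
    have e1 : (∫ V, A (torusLift M V) *
        B (Literature.MathematicalPhysics.QuantumLattice.configShift (-Pi.single 0 (t : ℤ))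
          (torusLift M V)) ∂(wilsonMeasure (d := 4) (L := M) ρ β)) =
        ∫ V, g (torusLift M V) * H V ∂(wilsonMeasure (d := 4) (L := M) ρ β) := h1
    have e2 : (∫ V, A (torusLift M V) ∂(wilsonMeasure (d := 4) (L := M) ρ β)) = m := h2
    have e3 : (∫ V, B (torusLift M V) ∂(wilsonMeasure (d := 4) (L := M) ρ β)) =
        ∫ V, H V ∂(wilsonMeasure (d := 4) (L := M) ρ β) := h3.symm
    rw [e1, e2, e3]
    simp_rw [sub_mul]
    rw [integral_sub hgHi (hHi.const_mul m), integral_const_mul]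
  rw [hcov]
  -- the kernel mean is within `Δ` of its torus average
  have hosc : ∀ V, |g (torusLift M V) - m| ≤ Δ := fun V => by
    have h := abs_sub_integral_le_of_forall (wilsonMeasure (d := 4) (L := M) ρ β) hgl
      (fun V => hgb _) (fun V V' => hΔ _ _) V
    simpa [hm] using h
  calc |∫ V, (g (torusLift M V) - m) * H V ∂(wilsonMeasure (d := 4) (L := M) ρ β)|
      ≤ Δ * CB := abs_integral_le_of_abs_le fun V => by
        rw [abs_mul]
        exact mul_le_mul (hosc V) (hHb V) (abs_nonneg _) ((abs_nonneg _).trans (hosc V))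
    _ = CB * Δ := mul_comm _ _

end Covariance

end Summit.QuantumFields.YangMills.Theorems.FiniteSizeCriterion

end
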